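import Summits.NavierStokesRegularity.FluidComputer.ClayBlowupAxisZoomData
import HarnessLib

/-!
# AXIS ZOOM BOUNDS for a Clay blow-up WITH force under a LOCAL TYPE-I HYPOTHESIS: KNSS's three
# bounds (wkbound), (wkbound2), (wkbound3) for the zoom at axis zoom data, and small tools

Cell `ns-blowup`, seat `ns-blowup-ecbridge-2` (g12; the E–C endpoint theory seat). LABEL: E–C typing
(KERNEL — no named fact, no new definition). WHAT THIS IS NOT: not Navier–Stokes evidence —
elementary bookkeeping for a rescaled copy of the velocity of the TYPE `ClayBlowup ν`; no
inhabitant is claimed. Companion memo: `run/shared/lean/pub/ns-blowup/ecbridge2/ECBRIDGE-2-MEMO-11.md`.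

## Content (Koch–Nadirashvili–Seregin–Šverák 2009, proof of Thm 6.2, arXiv p. 13, LOCALISED)

For the zoom `w = m⁻¹ • stPull m⁻² m⁻¹ τ_c y₀ u` (`m > 0`) centred at a point `y₀` of the meridian
half-plane (`(y₀)₁ = 0 ≤ (y₀)₀ = r`, `M = r m`): the rescaled distance to the axis is
`ρ(z) = cylRadius (z − single 0 (−M)) = m · |x'|` at the physical point `x = y₀ + m⁻¹ z`
(`cylRadius_zoom_axis`); a LOCAL Type-I bound `‖u(t, x)‖ ≤ C/√(T − t)` near `x₁` gives
(wkbound3) `‖w(σ, z)‖ ≤ C/√(−σ)` and the window bound `‖u‖ ≤ (C/√(−t)) m` on the physical window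
below `τ_c + m⁻² t` (`zoom_norm_le_typeI`, `window_norm_le_typeI`); KNSS's bound
`|x'|‖u(s, x)‖ ≤ 4M` on the good ball gives (wkbound2) `‖w(σ,z)‖ ρ(z) ≤ 4M`
(`zoom_norm_mul_cylRadius_le`) and (wkbound) `‖w(σ, z)‖ ≤ 8` for `‖z‖ ≤ M/2`
(`zoom_norm_le_eight`). Tools: `tendstoLocallyUniformly_of_eventually_eq_nhds` (locally uniform
convergence survives modifications which agree eventually near every point), monotonicity of the
Type-I profile `C/√(−τ)` and of the ratio `Λ(t) = max 4 (C/√(−t))` on `(−∞, 0)`.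

References: Koch–Nadirashvili–Seregin–Šverák, Acta Math. 203 (2009), proof of Thm 6.2
[cite: KochNadirashviliSereginSverak2009, proof of Thm 6.2 (arXiv pp. 12–13)].
-/

noncomputable section

namespace Summit.NavierStokesRegularity.FluidComputer

open Set MeasureTheory Filter Topology Function Metric
open scoped ENNReal NNReal
open Literature.Analysis Literature.Analysis.FluidPDE
open Summit.NavierStokesRegularity.NavierStokesRegularity

/-! ## §1 Tools -/

/-- **Locally uniform convergence survives an eventual local modification**: if `F_n → f` locally
uniformly and every point has a neighbourhood on which `G_n = F_n` for all large `n`, then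
`G_n → f` locally uniformly. [folklore] -/
theorem tendstoLocallyUniformly_of_eventually_eq_nhds {α β : Type*} [TopologicalSpace α]
    [UniformSpace β] {F G : ℕ → α → β} {f : α → β} (h : TendstoLocallyUniformly F f atTop)
    (heq : ∀ x, ∃ V ∈ 𝓝 x, ∀ᶠ n in atTop, ∀ y ∈ V, G n y = F n y) :
    TendstoLocallyUniformly G f atTop := by
  intro u hu x
  obtain ⟨t, ht, hev⟩ := h u hu x
  obtain ⟨V, hV, hVeq⟩ := heq x
  exact ⟨t ∩ V, inter_mem ht hV, (hev.and hVeq).mono fun n hn y hy => by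
    rw [hn.2 y hy.2]; exact hn.1 y hy.1⟩

/-- **The rescaled distance to the axis.** For a centre `y₀` on the meridian half-plane
(`(y₀)₁ = 0`) and `m > 0`, the point `z` of the zoom of scale `m⁻¹` centred at `y₀` sits at
distance `cylRadius (z − single 0 (−(m (y₀)₀))) = m |x'|` from the rescaled axis, `x = y₀ + m⁻¹z`
its physical position. [cite: KochNadirashviliSereginSverak2009, proof of Thm 6.2 (arXiv p. 13)] -/
theorem cylRadius_zoom_axis {y₀ : EuclideanSpace ℝ (Fin 3)} (hy1 : y₀ 1 = 0) {m : ℝ} (hm : 0 < m)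
    (z : EuclideanSpace ℝ (Fin 3)) :
    cylRadius (z - EuclideanSpace.single 0 (-(m * y₀ 0))) = m * cylRadius (y₀ + m⁻¹ • z) := by
  have key : ∀ {a b : EuclideanSpace ℝ (Fin 3)}, a 0 = b 0 → a 1 = b 1 → cylRadius a = cylRadius b :=
    fun h0 h1 => by simp only [cylRadius, h0, h1]
  have h : cylRadius (z - EuclideanSpace.single 0 (-(m * y₀ 0))) = cylRadius (m • (y₀ + m⁻¹ • z)) :=
    key (by simp [hm.ne']; ring) (by simp [hy1, hm.ne'])
  rw [h, cylRadius_smul, abs_of_pos hm]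

/-- A point on the meridian half-plane at distance `M ≥ 0`: `cylRadius (0 − single 0 (−M)) = M`.
[folklore] -/
theorem cylRadius_zero_sub_single {M : ℝ} (hM : 0 ≤ M) :
    cylRadius ((0 : EuclideanSpace ℝ (Fin 3)) - EuclideanSpace.single 0 (-M)) = M := by
  rw [cylRadius_eq_apply_zero (by simp) (by simp [hM])]
  simp

/-- The rescaled axis distance of `z` is at least `M − ‖z‖`. [folklore] -/
theorem sub_norm_le_cylRadius_sub_single {M : ℝ} (hM : 0 ≤ M) (z : EuclideanSpace ℝ (Fin 3)) :
    M - ‖z‖ ≤ cylRadius (z - EuclideanSpace.single 0 (-M)) := by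
  have h := cylRadius_le_cylRadius_add_norm_sub (z - EuclideanSpace.single 0 (-M))
    ((0 : EuclideanSpace ℝ (Fin 3)) - EuclideanSpace.single 0 (-M))
  rw [cylRadius_zero_sub_single hM, sub_sub_sub_cancel_right, zero_sub, norm_neg] at h
  linarith

/-- **The Type-I profile `C/√(−τ)` is monotone on `(−∞, 0)`** (`C ≥ 0`). [folklore] -/
theorem monotoneOn_typeI_profile {C : ℝ} (hC : 0 ≤ C) :
    MonotoneOn (fun τ : ℝ => C / Real.sqrt (-τ)) (Iio 0) := by
  intro a ha b hb hab
  have hb' : 0 < Real.sqrt (-b) := Real.sqrt_pos.2 (by simpa using hb)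
  exact div_le_div_of_nonneg_left hC hb' (Real.sqrt_le_sqrt (by linarith))

/-- **The ratio `Λ(t) = max 4 (C/√(−t))` is monotone on `(−∞, 0)`, and so is `Λ²`** (`C ≥ 0`).
[folklore] -/
theorem monotoneOn_ratio_sq {C : ℝ} (hC : 0 ≤ C) (P : ℝ) (hP : 0 ≤ P) :
    MonotoneOn (fun t : ℝ => (max 4 (C / Real.sqrt (-t))) ^ 2 * P) (Iio 0) := by
  intro a ha b hb hab
  have h1 : max 4 (C / Real.sqrt (-a)) ≤ max 4 (C / Real.sqrt (-b)) :=
    max_le_max le_rfl (monotoneOn_typeI_profile hC ha hb hab)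
  have h0 : (0 : ℝ) ≤ max 4 (C / Real.sqrt (-a)) := le_trans (by norm_num) (le_max_left _ _)
  exact mul_le_mul_of_nonneg_right (pow_le_pow_left₀ h0 h1 2) hP

/-- `√(m⁻² a) = m⁻¹ √a` for `m > 0`. [folklore] -/
theorem sqrt_inv_sq_mul {m : ℝ} (hm : 0 < m) (a : ℝ) :
    Real.sqrt (m⁻¹ ^ 2 * a) = m⁻¹ * Real.sqrt a := by
  rw [Real.sqrt_mul (sq_nonneg _), Real.sqrt_sq (inv_pos.2 hm).le]

namespace ClayBlowup

variable {ν : ℝ} (X : ClayBlowup ν)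

/-! ## §2 (wkbound3) and the window bound from a local Type-I hypothesis -/

/-- **The window bound**: under the local Type-I bound `‖u(t', x)‖ ≤ C/√(T − t')` on
`(t₀, T) × B(x₁, r₀)`, every physical time `t'` of the zoom window `[τ_c + m⁻²s, τ_c + m⁻²t]`
(`t < 0`, `τ_c < T`, `t₀ < τ_c + m⁻²s`) satisfies `‖u(t', x)‖ ≤ (C/√(−t)) m` on `B(x₁, r₀)`.
[cite: KochNadirashviliSereginSverak2009, proof of Thm 6.2, (wkbound3) (arXiv p. 13)] -/
theorem window_norm_le_typeI {x₁ : EuclideanSpace ℝ (Fin 3)} {r₀ t₀ C : ℝ} (hC : 0 ≤ C)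
    (hI : ∀ t ∈ Ioo t₀ X.T, ∀ x ∈ ball x₁ r₀, ‖X.u t x‖ ≤ C / Real.sqrt (X.T - t))
    {τc m s t : ℝ} (hτc : τc < X.T) (hm : 0 < m) (ht : t < 0)
    (hdom : t₀ < τc + m⁻¹ ^ 2 * s) :
    ∀ t' ∈ Icc (τc + m⁻¹ ^ 2 * s) (τc + m⁻¹ ^ 2 * t), ∀ x ∈ ball x₁ r₀,
      ‖X.u t' x‖ ≤ C / Real.sqrt (-t) * m := by
  intro t' ht' x hx
  have hc0 : 0 < m⁻¹ := inv_pos.2 hm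
  have hneg : 0 < m⁻¹ ^ 2 * (-t) := mul_pos (pow_pos hc0 2) (by linarith)
  have hgap : m⁻¹ ^ 2 * (-t) ≤ X.T - t' := by
    have := ht'.2; nlinarith [pow_pos hc0 2]
  have ht'T : t' < X.T := by linarith
  have h := hI t' ⟨hdom.trans_le ht'.1, ht'T⟩ x hx
  refine h.trans ?_
  have hs1 : Real.sqrt (m⁻¹ ^ 2 * (-t)) ≤ Real.sqrt (X.T - t') := Real.sqrt_le_sqrt hgap
  have hs0 : 0 < Real.sqrt (m⁻¹ ^ 2 * (-t)) := Real.sqrt_pos.2 hneg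
  calc C / Real.sqrt (X.T - t') ≤ C / Real.sqrt (m⁻¹ ^ 2 * (-t)) :=
        div_le_div_of_nonneg_left hC hs0 hs1
    _ = C / Real.sqrt (-t) * m := by
        rw [sqrt_inv_sq_mul hm]
        field_simp

/-- **(wkbound3) for the zoom**: `‖w(σ, z)‖ ≤ C/√(−σ)` for `σ < 0` with `t₀ < τ_c + m⁻²σ` and
`y₀ + m⁻¹z ∈ B(x₁, r₀)`, `w = m⁻¹ • stPull m⁻² m⁻¹ τ_c y₀ u`.
[cite: KochNadirashviliSereginSverak2009, proof of Thm 6.2, (wkbound3) (arXiv p. 13)] -/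
theorem zoom_norm_le_typeI {x₁ : EuclideanSpace ℝ (Fin 3)} {r₀ t₀ C : ℝ} (hC : 0 ≤ C)
    (hI : ∀ t ∈ Ioo t₀ X.T, ∀ x ∈ ball x₁ r₀, ‖X.u t x‖ ≤ C / Real.sqrt (X.T - t))
    {τc m σ : ℝ} (hτc : τc < X.T) (hm : 0 < m) (hσ : σ < 0) (hdom : t₀ < τc + m⁻¹ ^ 2 * σ)
    {y₀ z : EuclideanSpace ℝ (Fin 3)} (hz : y₀ + m⁻¹ • z ∈ ball x₁ r₀) :
    ‖(m⁻¹ • stPull (m⁻¹ ^ 2) m⁻¹ τc y₀ X.u) σ z‖ ≤ C / Real.sqrt (-σ) := by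
  have hc0 : 0 < m⁻¹ := inv_pos.2 hm
  have h := X.window_norm_le_typeI hC hI hτc hm hσ hdom (τc + m⁻¹ ^ 2 * σ)
    ⟨le_rfl, le_rfl⟩ _ hz
  rw [smul_stPull_apply, norm_smul, Real.norm_of_nonneg hc0.le]
  calc m⁻¹ * ‖X.u (τc + m⁻¹ ^ 2 * σ) (y₀ + m⁻¹ • z)‖ ≤ m⁻¹ * (C / Real.sqrt (-σ) * m) :=
        mul_le_mul_of_nonneg_left h hc0.le
    _ = C / Real.sqrt (-σ) := by field_simp

/-! ## §3 (wkbound2) and (wkbound) from KNSS's bound on the good ball -/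

/-- **(wkbound2) for the zoom**: if `|x'|‖u(s, x)‖ ≤ 4M` for `s ∈ [t_b, τ_c]`, `x ∈ B(y₀, d/2)`,
then for every zoomed time `σ` with `τ_c + m⁻²σ ∈ [t_b, τ_c]` and every `‖z‖ < d m/2`,
`‖w(σ, z)‖ · cylRadius (z − single 0 (−(m (y₀)₀))) ≤ 4M` (`(y₀)₁ = 0`).
[cite: KochNadirashviliSereginSverak2009, proof of Thm 6.2, (wkbound2) (arXiv p. 13)] -/
theorem zoom_norm_mul_cylRadius_le {y₀ : EuclideanSpace ℝ (Fin 3)} (hy1 : y₀ 1 = 0)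
    {t_b τc d Mx : ℝ}
    (hB : ∀ s ∈ Icc t_b τc, ∀ x ∈ ball y₀ (d / 2), cylRadius x * ‖X.u s x‖ ≤ 4 * Mx)
    {m σ : ℝ} (hm : 0 < m) (hσ : τc + m⁻¹ ^ 2 * σ ∈ Icc t_b τc) {z : EuclideanSpace ℝ (Fin 3)}
    (hz : ‖z‖ < d * m / 2) :
    ‖(m⁻¹ • stPull (m⁻¹ ^ 2) m⁻¹ τc y₀ X.u) σ z‖ *
        cylRadius (z - EuclideanSpace.single 0 (-(m * y₀ 0))) ≤ 4 * Mx := by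
  have hc0 : 0 < m⁻¹ := inv_pos.2 hm
  have hball : y₀ + m⁻¹ • z ∈ ball y₀ (d / 2) := by
    rw [mem_ball, dist_eq_norm, add_sub_cancel_left, norm_smul, Real.norm_of_nonneg hc0.le]
    calc m⁻¹ * ‖z‖ < m⁻¹ * (d * m / 2) := mul_lt_mul_of_pos_left hz hc0
      _ = d / 2 := by field_simp
  have h := hB _ hσ _ hball
  rw [smul_stPull_apply, norm_smul, Real.norm_of_nonneg hc0.le, cylRadius_zoom_axis hy1 hm]
  calc m⁻¹ * ‖X.u (τc + m⁻¹ ^ 2 * σ) (y₀ + m⁻¹ • z)‖ * (m * cylRadius (y₀ + m⁻¹ • z)) =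
      cylRadius (y₀ + m⁻¹ • z) * ‖X.u (τc + m⁻¹ ^ 2 * σ) (y₀ + m⁻¹ • z)‖ := by field_simp
    _ ≤ 4 * Mx := h

/-- **(wkbound) for the zoom near the vertex**: with `M = m (y₀)₀ ≥ 0` as above, for `‖z‖ ≤ M/2`
(and `‖z‖ < d m/2`) one has `‖w(σ, z)‖ ≤ 8`: the rescaled axis distance of `z` is `≥ M − ‖z‖ ≥ M/2`.
[cite: KochNadirashviliSereginSverak2009, proof of Thm 6.2, (wkbound) (arXiv p. 13)] -/
theorem zoom_norm_le_eight {y₀ : EuclideanSpace ℝ (Fin 3)} (hy1 : y₀ 1 = 0)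
    {t_b τc d Mx m : ℝ} (hm : 0 < m) (hMx : Mx = m * y₀ 0) (hMx0 : 0 < Mx)
    (hB : ∀ s ∈ Icc t_b τc, ∀ x ∈ ball y₀ (d / 2), cylRadius x * ‖X.u s x‖ ≤ 4 * Mx)
    {σ : ℝ} (hσ : τc + m⁻¹ ^ 2 * σ ∈ Icc t_b τc) {z : EuclideanSpace ℝ (Fin 3)}
    (hz : ‖z‖ < d * m / 2) (hzM : ‖z‖ ≤ Mx / 2) :
    ‖(m⁻¹ • stPull (m⁻¹ ^ 2) m⁻¹ τc y₀ X.u) σ z‖ ≤ 8 := by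
  have h := X.zoom_norm_mul_cylRadius_le hy1 hB hm hσ hz
  rw [← hMx] at h
  have hρ : Mx / 2 ≤ cylRadius (z - EuclideanSpace.single 0 (-Mx)) := by
    have := sub_norm_le_cylRadius_sub_single hMx0.le z; linarith
  have hρ0 : 0 < cylRadius (z - EuclideanSpace.single 0 (-Mx)) := lt_of_lt_of_le (by linarith) hρ
  rw [← le_div_iff₀ hρ0] at h
  refine h.trans ?_
  rw [div_le_iff₀ hρ0]
  linarith

/-- **The truncated (wkbound2), KNSS's form**: for a truncation `χ • w` by `χ : ℝ³ → [0, 1]`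
supported in `B(0, d m/2)`, if `‖w(σ, z)‖ ≤ C/√(−σ)` and `‖w(σ,z)‖ρ(z) ≤ 4M` on that ball, then
`‖χ(z) w(σ, z)‖ (M√(−σ) + ρ(z)) ≤ (C + 4) M` at EVERY `z` (`ρ(z) = cylRadius (z − single 0 (−M))`,
`M ≥ 0`, `σ < 0`). [cite: KochNadirashviliSereginSverak2009, proof of Thm 6.2, (wkbound2) (arXiv p. 13)] -/
theorem truncated_wkbound2 {w : EuclideanSpace ℝ (Fin 3) → EuclideanSpace ℝ (Fin 3)}
    {χ : EuclideanSpace ℝ (Fin 3) → ℝ} {C Mx Rz σ : ℝ} (hMx : 0 ≤ Mx) (hσ : σ < 0) (hC : 0 ≤ C)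
    (hχ01 : ∀ y, 0 ≤ χ y ∧ χ y ≤ 1) (hχ0 : ∀ y, Rz ≤ ‖y‖ → χ y = 0)
    (hI : ∀ z, ‖z‖ < Rz → ‖w z‖ ≤ C / Real.sqrt (-σ))
    (hρ : ∀ z, ‖z‖ < Rz → ‖w z‖ * cylRadius (z - EuclideanSpace.single 0 (-Mx)) ≤ 4 * Mx)
    (z : EuclideanSpace ℝ (Fin 3)) :
    ‖χ z • w z‖ * (Mx * Real.sqrt (-σ) + cylRadius (z - EuclideanSpace.single 0 (-Mx))) ≤
      (C + 4) * Mx := by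
  by_cases hz : Rz ≤ ‖z‖
  · rw [hχ0 z hz, zero_smul, norm_zero, zero_mul]; positivity
  · push Not at hz
    have hs0 : 0 < Real.sqrt (-σ) := Real.sqrt_pos.2 (by linarith)
    have h1 : ‖w z‖ * (Mx * Real.sqrt (-σ)) ≤ C * Mx := by
      have h := hI z hz
      rw [le_div_iff₀ hs0] at h
      nlinarith [h, hMx]
    have h2 := hρ z hz
    have hle : ‖χ z • w z‖ ≤ ‖w z‖ := by
      rw [norm_smul, Real.norm_of_nonneg (hχ01 z).1]
      exact mul_le_of_le_one_left (norm_nonneg _) (hχ01 z).2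
    have hsum0 : 0 ≤ Mx * Real.sqrt (-σ) + cylRadius (z - EuclideanSpace.single 0 (-Mx)) := by
      have := cylRadius_nonneg (z - EuclideanSpace.single 0 (-Mx)); positivity
    calc ‖χ z • w z‖ * (Mx * Real.sqrt (-σ) + cylRadius (z - EuclideanSpace.single 0 (-Mx)))
        ≤ ‖w z‖ * (Mx * Real.sqrt (-σ) + cylRadius (z - EuclideanSpace.single 0 (-Mx))) :=
          mul_le_mul_of_nonneg_right hle hsum0
      _ = ‖w z‖ * (Mx * Real.sqrt (-σ)) + ‖w z‖ * cylRadius (z - EuclideanSpace.single 0 (-Mx)) := by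
          ring
      _ ≤ C * Mx + 4 * Mx := add_le_add h1 h2
      _ = (C + 4) * Mx := by ring

/-- **The truncated (wkbound) off the cylinder**: with the data of `truncated_wkbound2`, for
`ρ(z) > M/2` (`M > 0`) one has `‖χ(z) w(σ, z)‖ ≤ 8`.
[cite: KochNadirashviliSereginSverak2009, proof of Thm 6.2, (wkbound) (arXiv p. 13)] -/
theorem truncated_wkbound_off_cylinder {w : EuclideanSpace ℝ (Fin 3) → EuclideanSpace ℝ (Fin 3)}
    {χ : EuclideanSpace ℝ (Fin 3) → ℝ} {Mx Rz : ℝ} (hMx : 0 < Mx)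
    (hχ01 : ∀ y, 0 ≤ χ y ∧ χ y ≤ 1) (hχ0 : ∀ y, Rz ≤ ‖y‖ → χ y = 0)
    (hρ : ∀ z, ‖z‖ < Rz → ‖w z‖ * cylRadius (z - EuclideanSpace.single 0 (-Mx)) ≤ 4 * Mx)
    {z : EuclideanSpace ℝ (Fin 3)} (hz : Mx / 2 < cylRadius (z - EuclideanSpace.single 0 (-Mx))) :
    ‖χ z • w z‖ ≤ 8 := by
  by_cases hzR : Rz ≤ ‖z‖
  · rw [hχ0 z hzR, zero_smul, norm_zero]; norm_num
  · push Not at hzR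
    have hρ0 : 0 < cylRadius (z - EuclideanSpace.single 0 (-Mx)) := lt_trans (by linarith) hz
    have h := hρ z hzR
    rw [← le_div_iff₀ hρ0] at h
    have h8 : 4 * Mx / cylRadius (z - EuclideanSpace.single 0 (-Mx)) ≤ 8 := by
      rw [div_le_iff₀ hρ0]; linarith
    calc ‖χ z • w z‖ ≤ ‖w z‖ := by
          rw [norm_smul, Real.norm_of_nonneg (hχ01 z).1]
          exact mul_le_of_le_one_left (norm_nonneg _) (hχ01 z).2
      _ ≤ 8 := h.trans h8

end ClayBlowup

/-! ## §4 Arithmetic of the axis zoom data (appended, g12) -/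

/-- **The `Θ`-collection of the axis zoom data is `≤ 39/(k+1)`**: with `0 < d`, `1 ≤ m`,
`k + 1 ≤ m`, `k + 1 ≤ d m`, `k + 1 ≤ d² m` and `R = d m/2` (so `R ≥ (k+1)/2` and
`d⁴ m³ = (d² m)² m ≥ k + 1`): `1/R + 1/R² + (1 + m)/R⁴ + m⁻¹ ≤ 39/(k + 1)` (g11's arithmetic for the
far-field budget of the local zoom, here for the axis zoom). [folklore] -/
theorem theta_le_of_axis_data {d m : ℝ} {k : ℕ} (hd0 : 0 < d) (hM1 : 1 ≤ m)
    (hk1 : (k : ℝ) + 1 ≤ m) (hdM : (k : ℝ) + 1 ≤ d * m) (hLm : (k : ℝ) + 1 ≤ d ^ 2 * m) :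
    1 / (d * m / 2) + 1 / (d * m / 2) ^ 2 + (1 + m) / (d * m / 2) ^ 4 + m⁻¹ ≤ 39 / ((k : ℝ) + 1) := by
  have hm0 : 0 < m := lt_of_lt_of_le one_pos hM1
  have hR0 : 0 < d * m / 2 := by positivity
  have hRk : ((k : ℝ) + 1) / 2 ≤ d * m / 2 := by linarith
  have hk0 : (0 : ℝ) < (k : ℝ) + 1 := by positivity
  have h1 : 1 / (d * m / 2) ≤ 2 / ((k : ℝ) + 1) := by
    rw [div_le_div_iff₀ hR0 hk0]; linarith
  have h3 : m⁻¹ ≤ 1 / ((k : ℝ) + 1) := by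
    rw [inv_eq_one_div, div_le_div_iff₀ hm0 hk0]; linarith
  have h2 : (1 + m) / (d * m / 2) ^ 4 ≤ 32 / ((k : ℝ) + 1) := by
    have hR4 : (d * m / 2) ^ 4 = (d * m) ^ 4 / 16 := by ring
    have hdM3 : (k : ℝ) + 1 ≤ d ^ 4 * m ^ 3 := by
      have h5 : ((k : ℝ) + 1) ^ 2 ≤ (d ^ 2 * m) ^ 2 := pow_le_pow_left₀ hk0.le hLm 2
      have h6 : ((k : ℝ) + 1) ^ 2 * 1 ≤ (d ^ 2 * m) ^ 2 * m :=
        mul_le_mul h5 hM1 zero_le_one (by positivity)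
      have h7 : (k : ℝ) + 1 ≤ ((k : ℝ) + 1) ^ 2 * 1 := by nlinarith
      calc (k : ℝ) + 1 ≤ ((k : ℝ) + 1) ^ 2 * 1 := h7
        _ ≤ (d ^ 2 * m) ^ 2 * m := h6
        _ = d ^ 4 * m ^ 3 := by ring
    rw [hR4, div_le_div_iff₀ (by positivity) hk0]
    have h8 : (1 + m) * ((k : ℝ) + 1) ≤ 2 * m * (d ^ 4 * m ^ 3) := by
      have : (1 + m) ≤ 2 * m := by linarith
      exact mul_le_mul this hdM3 hk0.le (by positivity)
    calc (1 + m) * ((k : ℝ) + 1) ≤ 2 * m * (d ^ 4 * m ^ 3) := h8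
      _ = 32 * ((d * m) ^ 4 / 16) := by ring
  have h4 : 1 / (d * m / 2) ^ 2 ≤ 4 / ((k : ℝ) + 1) := by
    have hsq0 : (((k : ℝ) + 1) / 2) ^ 2 ≤ (d * m / 2) ^ 2 := pow_le_pow_left₀ (by positivity) hRk 2
    have hk1' : (1 : ℝ) ≤ (k : ℝ) + 1 := by linarith [k.cast_nonneg (α := ℝ)]
    have hsq : ((k : ℝ) + 1) / 4 ≤ (d * m / 2) ^ 2 := by nlinarith [hsq0, hk1']
    rw [div_le_div_iff₀ (pow_pos hR0 2) hk0]
    nlinarith [hsq, hk0]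
  calc 1 / (d * m / 2) + 1 / (d * m / 2) ^ 2 + (1 + m) / (d * m / 2) ^ 4 + m⁻¹
      ≤ 2 / ((k : ℝ) + 1) + 4 / ((k : ℝ) + 1) + 32 / ((k : ℝ) + 1) + 1 / ((k : ℝ) + 1) :=
        add_le_add (add_le_add (add_le_add h1 h4) h2) h3
    _ = 39 / ((k : ℝ) + 1) := by ring

namespace ClayBlowup

/-- **The zoomed windows recede**: if `τ_k ∈ [t_b, T)` and `k + 1 ≤ m_k ≤ ‖u(τ_k, y_k)‖`, then `A_k = −(τ_k − t_b) m_k² → −∞` (the centres are driven to the blow-up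
time because `u` is bounded on every earlier slab). [cite: KochNadirashviliSereginSverak2009, proof of Thm 6.2 (arXiv p. 13)] -/
theorem tendsto_axis_zoom_window {ν : ℝ} (X : ClayBlowup ν) (hν : 0 < ν) {t_b : ℝ} (ht_b : t_b ∈ Ico 0 X.T)
    {τ : ℕ → ℝ} {y : ℕ → EuclideanSpace ℝ (Fin 3)} {m : ℕ → ℝ} (hτ : ∀ k, τ k ∈ Ico t_b X.T)
    (hm : ∀ k, m k ≤ ‖X.u (τ k) (y k)‖) (hk1 : ∀ k : ℕ, (k : ℝ) + 1 ≤ m k) :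
    Tendsto (fun k => -(τ k - t_b) * m k ^ 2) atTop atBot := by
  obtain ⟨B₀, hB₀⟩ := X.exists_norm_le hν (show (t_b + X.T) / 2 < X.T by linarith [ht_b.2])
  have hM1 : ∀ k, 1 ≤ m k := fun k => le_trans (by linarith [k.cast_nonneg (α := ℝ)]) (hk1 k)
  have hev : ∀ᶠ k : ℕ in atTop, -(τ k - t_b) * m k ^ 2 ≤ -((X.T - t_b) / 2) * ((k : ℝ) + 1) := by
    refine (eventually_gt_atTop ⌈B₀⌉₊).mono fun k hk => ?_
    have hMB : B₀ < m k := by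
      have h1 : (⌈B₀⌉₊ : ℝ) < k := by exact_mod_cast hk
      linarith [Nat.le_ceil B₀, hk1 k]
    have hτk : (t_b + X.T) / 2 < τ k := by
      by_contra h
      push Not at h
      exact absurd (hMB.trans_le (hm k)) (not_lt.2 (hB₀ (τ k) ⟨ht_b.1.trans (hτ k).1, h⟩ (y k)))
    have h2 : (X.T - t_b) / 2 ≤ τ k - t_b := by linarith
    have h3 : (k : ℝ) + 1 ≤ m k ^ 2 := by nlinarith [hk1 k, hM1 k]
    nlinarith [h2, h3, sub_pos.2 ht_b.2]
  refine tendsto_atBot_mono' atTop hev ?_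
  have h1 : Tendsto (fun k : ℕ => (k : ℝ) + 1) atTop atTop :=
    tendsto_atTop_add_const_right _ _ tendsto_natCast_atTop_atTop
  exact h1.const_mul_atTop_of_neg (by linarith [ht_b.2])

end ClayBlowup

end Summit.NavierStokesRegularity.FluidComputer

end
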